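import Summits.QuantumFields.QCD.Theses.NestedDissectionSea

/-!
# Sketch — crux-ideate stmt-QuantumFields-13901 (`CoerciveSea`), round 1, ideator 1

First lemmas of three idea cards, typed over existing declarations (no proofs required; every
`def … : Prop` must elaborate).  Namespace is scratch-only.

* Card `chirality-collapses-pseudospectrum` — `ChiralPseudomodeForcesCrossing` (deterministic,
  Rellich/law-of-motion) and the transfer target `CensusSea` (`CoerciveSea` with the
  separator event of clause (i) replaced by "crossing within `t/(χ₀ s₀)` of the valence mass, or an
  achiral `t/s₀`-pseudomode").
* Card `twisted-sixth-moment` — `TwistedSixthMomentDominates` (deterministic Markov step: a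
  `τ`-singular separator forces `τ⁶ Tr (D_c†D_c + τ²)⁻³ ≥ 1/8`).
* Card `moduli-spectral-averaging` — `LawOfMotionSolvability` (exact first-order solvability
  identity behind `λ' = ⟨w, γ₅ D' w⟩/⟨w, γ₅ w⟩`), PROVED below as `lawOfMotionSolvability_holds`.
-/

namespace Summit.QuantumFields.QCD.Cruxes.CoerciveSea.Ideator1Sketch

open scoped BigOperators Matrix ComplexConjugate Classical
open Literature.MathematicalPhysics.QuantumLattice Literature.MathematicalPhysics.QuantumFieldTheory
  Literature.Probability.LatticeModels

/-- Card 1, first lemma (deterministic linear algebra; Rellich branches of the Hermitian pencil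
`Γ₅ (D_c(0) + μ)` have slope = chirality of the eigenvector).  If the Dirichlet Wilson cell at the
valence mass `μf` has a `τ`-pseudomode, and every `τ`-pseudomode of the cell at every mass in the
window `[μf - τ/χ₀, μf + τ/χ₀]` has chirality at least `χ₀` (in absolute value, relative to its
norm), then the cell has an exact real-eigenvalue CROSSING inside that window. -/
def ChiralPseudomodeForcesCrossing : Prop :=
  ∀ (N : ℕ) [NeZero N] (U : GaugeConfig 4 N (Matrix.specialUnitaryGroup (Fin 3) ℂ))
    (s : Fin 4 → ℕ) (μf τ χ₀ : ℝ), 0 < τ → 0 < χ₀ →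
    (∃ v : {p // wilsonBox (0 : TorusSite 4 N) s p} → ℂ, v ≠ 0 ∧
      ∑ p, ‖(wilsonCell U μf 0 s).mulVec v p‖ ^ 2 < τ ^ 2 * ∑ p, ‖v p‖ ^ 2) →
    (∀ μ ∈ Set.Icc (μf - τ / χ₀) (μf + τ / χ₀),
      ∀ v : {p // wilsonBox (0 : TorusSite 4 N) s p} → ℂ, v ≠ 0 →
        ∑ p, ‖(wilsonCell U μ 0 s).mulVec v p‖ ^ 2 ≤ τ ^ 2 * ∑ p, ‖v p‖ ^ 2 →
        χ₀ * ∑ p, ‖v p‖ ^ 2 ≤ ‖∑ p, star (v p) * gammaFive p.1.2.2 p.1.2.2 * v p‖) →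
    ∃ μ' ∈ Set.Icc (μf - τ / χ₀) (μf + τ / χ₀), (wilsonCell U μ' 0 s).det = 0

/-- Card 1, transfer target `C⁺ = CensusSea`: `CoerciveSea` with clause (i) (the separator
Wegner law) REPLACED by the crossing-census law and clauses (ii)–(iii) kept VERBATIM under the
SAME `∃ reg … ∃ χ₀ … ∀ m ∃ R` prefix (one extra datum, the chirality floor `χ₀ ∈ (0,1]`).  The new
clause (i′): for every window box, flavour and `t ∈ (0,1]`, the phase-quenched probability of
(A) a CROSSING of the Dirichlet cell within bare-mass distance `t/(χ₀ s₀)` of the valence mass, or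
(B) an ACHIRAL `t/s₀`-pseudomode of the cell at some mass in that window, is `≤ C t^α`.  Since
`HasSingularSeparator U μ s τ` gives a `τ`-pseudomode of the cell and `ChiralPseudomodeForcesCrossing`
puts every pseudomode configuration into A ∪ B, `CensusSea → CoerciveSea` is monotonicity of `P`
(statement `CensusSeaSuffices`). Generated from the ledger signature of stmt-13901 by textual
replacement of the (i)-event only. -/
def CensusSea : Prop :=
  ∀ Nf : ℕ, (Nf = 2 ∨ Nf = 3) → ∃ reg : QCDRegularisation Nf, reg.HasMassScaling ∧ (reg.scheme 0 0 0).HasAsymptoticScaling ∧ ∃ M₀ : ℝ, 0 ≤ M₀ ∧ ∃ b₀ : ℕ, 2 ≤ b₀ ∧ ∃ ℓ : ℝ, 0 < ℓ ∧ ∃ χ₀ : ℝ, 0 < χ₀ ∧ χ₀ ≤ 1 ∧ ∀ m : Fin Nf → ℝ, (∀ f, M₀ < m f) → ∃ R : ℝ, 0 < R ∧ (∃ C : ℝ, 0 < C ∧ ∃ α : ℝ, 0 < α ∧ ∀ᶠ k : ℕ in Filter.atTop, ∀ S : ℕ, R ≤ reg.a k * (2 * S + 1) → let N : ℕ := 2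 * S + 1; let mq : Fin Nf → ℝ := fun f => reg.mcrit k + reg.a k * m f / reg.Zm k; let wt : GaugeConfig 4 N (Matrix.specialUnitaryGroup (Fin 3) ℂ) → ℝ := fun U => ∏ f, ‖fermionDet (wilsonDirac (fundamentalRep (Fin 3)) U (mq f) 1)‖; let P : (GaugeConfig 4 N (Matrix.specialUnitaryGroup (Fin 3) ℂ) → Prop) → ℝ := fun E => (∫ U, (if E U then (1 : ℝ) else 0) * wt U ∂(wilsonMeasure (d := 4) (L := N) (fundamentalRep (Fin 3)) (reg.β k))) / (∫ U, wt U ∂(wilsonMeasure (d := 4) (L := N) (fundamentalRep (Fin 3)) (reg.β k))); ∀ s : Fin 4 → ℕ, (∀ i, b₀ ≤ s i ∧ s i ≤ N ∧ (s i : ℝ) * reg.a k ≤ ℓ) → (∀ i j, s i ≤ 2 * s j) → ∀ f : Fin Nf, ∀ t : ℝ, 0 < t → t ≤ 1 → P (fun U => (∃ μ' : ℝ, |μ' - mq f| ≤ t / (χ₀ * s 0) ∧ (wilsonCell U μ' 0 s).det = 0) ∨ (∃ μ : ℝ, |μ - mq f| ≤ t / (χ₀ * s 0) ∧ ∃ v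 : {p // wilsonBox (0 : TorusSite 4 N) s p} → ℂ, v ≠ 0 ∧ ∑ p, ‖(wilsonCell U μ 0 s).mulVec v p‖ ^ 2 ≤ (t / s 0) ^ 2 * ∑ p, ‖v p‖ ^ 2 ∧ ‖∑ p, star (v p) * gammaFive p.1.2.2 p.1.2.2 * v p‖ < χ₀ * ∑ p, ‖v p‖ ^ 2)) ≤ C * t ^ α) ∧ (∀ ε : ℝ, 0 < ε → ∀ᶠ k : ℕ in Filter.atTop, ∀ S : ℕ, R ≤ reg.a k * (2 * S + 1) → let N : ℕ := 2 * S + 1; let mq : Fin Nf → ℝ := fun f => reg.mcrit k + reg.a k * m f / reg.Zm k; let wt : GaugeConfig 4 N (Matrix.specialUnitaryGroup (Fin 3) ℂ) → ℝ := fun U => ∏ f, ‖fermionDet (wilsonDirac (fundamentalRep (Fin 3)) U (mq f) 1)‖; let P : (GaugeConfig 4 N (Matrix.specialUnitaryGroup (Fin 3) ℂ) → Prop) → ℝ := fun E => (∫ U, (if E U then (1 : ℝ) else 0) * wt U ∂(wilsonMeasure (d := 4) (L := N) (fundamentalRep (Fin 3)) (reg.β k))) / (∫ U, wt U ∂(wilsonMeasure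 (d := 4) (L := N) (fundamentalRep (Fin 3)) (reg.β k))); let J : ℕ := Nat.log 2 (⌊ℓ / reg.a k⌋₊ / b₀) + 1; ∃ δ : ℕ → ℝ, ∑ j ∈ Finset.range J, δ j ≤ ε ∧ ∀ j < J, ∀ s : Fin 4 → ℕ, (∀ i, b₀ * 2 ^ j ≤ s i ∧ s i < b₀ * 2 ^ (j + 2) ∧ s i ≤ N ∧ (s i : ℝ) * reg.a k ≤ ℓ) → P (fun U => ∃ f, IsSignDefect U (mq f) j s) ≤ δ j) ∧ (∀ M : ℝ, M₀ < M → ∀ᶠ k : ℕ in Filter.atTop, ∀ S : ℕ, R ≤ reg.a k * (2 * S + 1) → let N : ℕ := 2 * S + 1; let mq : Fin Nf → ℝ := fun f => reg.mcrit k + reg.a k * m f / reg.Zm k; let wt : GaugeConfig 4 N (Matrix.specialUnitaryGroup (Fin 3) ℂ) → ℝ := fun U => ∏ f, ‖fermionDet (wilsonDirac (fundamentalRep (Fin 3)) U (mq f) 1)‖; (1 / 4 : ℝ) ≤ (∫ U, (if (fermionDet (wilsonDirac (fundamentalRep (Fin 3)) U (reg.mcrit k - reg.a k * M / reg.Zm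 k) 1)).re < 0 then (1 : ℝ) else 0) * wt U ∂(wilsonMeasure (d := 4) (L := N) (fundamentalRep (Fin 3)) (reg.β k))) / (∫ U, wt U ∂(wilsonMeasure (d := 4) (L := N) (fundamentalRep (Fin 3)) (reg.β k))))

/-- Card 1, the sufficiency claim the crux-plan skeleton must kernel-check (pure logic +
monotonicity of the phase-quenched ratio in the event; no analysis). -/
def CensusSeaSuffices : Prop :=
  ChiralPseudomodeForcesCrossing → CensusSea →
    Summit.QuantumFields.QCD.Theses.NestedDissectionSea.CoerciveSea

/-- Card 2, first lemma (deterministic Markov step, size S): a `τ`-singular separator gives a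
`τ`-pseudomode of the whole Dirichlet cell (harmonic vectors have their residual on the
separator), hence `λ_min(D_c† D_c) < τ²` and `τ⁶ · Tr (D_c† D_c + τ²)⁻³ ≥ τ⁶ (2τ²)⁻³ = 1/8`.
So `P(HasSingularSeparator) ≤ 8 · E[M₃(τ)]` with the UV-finite twisted sixth moment
`M₃(τ) = τ⁶ Tr (D_c†D_c + τ²)⁻³ = τ⁶ Tr [(D_c + iτγ₅)⁻¹ (D_c - iτγ₅)⁻¹]³`. -/
def TwistedSixthMomentDominates : Prop :=
  ∀ (N : ℕ) [NeZero N] (U : GaugeConfig 4 N (Matrix.specialUnitaryGroup (Fin 3) ℂ))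
    (μ : ℝ) (s : Fin 4 → ℕ) (τ : ℝ), 0 < τ → HasSingularSeparator U μ s τ →
    (1 / 8 : ℝ) ≤ τ ^ 6 *
      (Matrix.trace (((wilsonCell U μ 0 s)ᴴ * wilsonCell U μ 0 s +
        ((τ ^ 2 : ℝ) : ℂ) • (1 : Matrix {p // wilsonBox (0 : TorusSite 4 N) s p}
          {p // wilsonBox (0 : TorusSite 4 N) s p} ℂ))⁻¹ ^ 3)).re

/-- Card 3, first lemma (exact algebra behind the law of motion `δμ = -⟨w, Γ D₁ w⟩/⟨w, Γ w⟩`):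
for a `Γ`-Hermitian `D₀` (`Γ D₀ Γ = D₀ᴴ`, `Γ² = 1`, `Γ = Γᴴ`) with kernel vector `w`, `Γ w` is a
LEFT kernel vector, so any exact solution `(D₀ + D₁ + δ)(w + w₁) = 0` of the perturbed crossing
problem satisfies `δ ⟨Γw, w⟩ + ⟨Γw, D₁ w⟩ = -⟨Γw, (D₁ + δ) w₁⟩` (the right side is second
order).  With `D₁ = ∂_θ D_c` along a link deformation this is the velocity field of the
spectral-averaging argument (the "chiral colour current" of the mode through the link). -/
def LawOfMotionSolvability : Prop :=
  ∀ (n : ℕ) (D₀ D₁ Γ : Matrix (Fin n) (Fin n) ℂ) (w w₁ : Fin n → ℂ) (δ : ℂ),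
    Γ * D₀ * Γ = D₀ᴴ → Γ * Γ = 1 → Γᴴ = Γ → D₀.mulVec w = 0 →
    (D₀ + D₁ + δ • (1 : Matrix (Fin n) (Fin n) ℂ)).mulVec (w + w₁) = 0 →
    δ * (star (Γ.mulVec w) ⬝ᵥ w) + star (Γ.mulVec w) ⬝ᵥ D₁.mulVec w =
      -(star (Γ.mulVec w) ⬝ᵥ (D₁ + δ • (1 : Matrix (Fin n) (Fin n) ℂ)).mulVec w₁)

/-- `LawOfMotionSolvability` PROVED (plain Mathlib matrix algebra; axioms standard). -/
theorem lawOfMotionSolvability_holds : LawOfMotionSolvability := by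
  intro n D₀ D₁ Γ w w₁ δ hΓD hΓΓ hΓ h0 h
  -- `Γ w` is a left null vector of `D₀`
  have h1 : Γ * D₀ = D₀ᴴ * Γ := by
    calc Γ * D₀ = Γ * D₀ * (Γ * Γ) := by rw [hΓΓ, Matrix.mul_one]
      _ = (Γ * D₀ * Γ) * Γ := by simp only [Matrix.mul_assoc]
      _ = D₀ᴴ * Γ := by rw [hΓD]
  have key : star (Γ *ᵥ w) ᵥ* D₀ = 0 := by
    rw [Matrix.star_mulVec, hΓ, Matrix.vecMul_vecMul, h1, ← Matrix.vecMul_vecMul,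
      ← Matrix.star_mulVec, h0, star_zero, Matrix.zero_vecMul]
  have hz : star (Γ *ᵥ w) ⬝ᵥ (D₀ *ᵥ w₁) = 0 := by
    rw [Matrix.dotProduct_mulVec, key, zero_dotProduct]
  have hpair := congrArg (fun v => star (Γ *ᵥ w) ⬝ᵥ v) h
  simp only [Matrix.add_mulVec, Matrix.mulVec_add, Matrix.smul_mulVec, Matrix.one_mulVec,
    dotProduct_add, dotProduct_smul, dotProduct_zero, h0, hz, smul_eq_mul, zero_add] at hpair
  simp only [Matrix.add_mulVec, Matrix.smul_mulVec, Matrix.one_mulVec, dotProduct_add,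
    dotProduct_smul, smul_eq_mul]
  linear_combination hpair

end Summit.QuantumFields.QCD.Cruxes.CoerciveSea.Ideator1Sketch
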